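import Summits.AtomisticToContinuum.BoseEinsteinCondensation.Theses.BECInfraredBound
import Summits.AtomisticToContinuum.BoseEinsteinCondensation.Theorems.BECCutLineWeakDisorderWitnessTransfer
import Summits.AtomisticToContinuum.BoseEinsteinCondensation.Theorems.BECCutLineWeakDisorderZeroModeOfLandscape
import Summits.AtomisticToContinuum.BoseEinsteinCondensation.Theorems.BECCutLineWeakDisorderFlatModeFromLandscape
import Summits.AtomisticToContinuum.BoseEinsteinCondensation.Theorems.BECCutLineWeakDisorderOccupationStability
import Summits.AtomisticToContinuum.BoseEinsteinCondensation.Theorems.BECCutLineWeakDisorderLateCoreSplitLateWitnessTransfer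
import HarnessLib

/-!
# Crux `TwoReplicaTransienceBound` (stmt-AtomisticToContinuum-9687), line `late-core-split`:
# NECESSITY CERTIFICATE — the crux (resp. its late core Z ∧ A) together with `GroundStateRigidity`
# proves the zero-mode target `BecZeroModeThesis` (item stmt-AtomisticToContinuum-0686) BY NAME

Support file (`--supports stmt-AtomisticToContinuum-9687`; closes nothing). Pure composition of
theorems already in the tree:

* `WitnessTransfer_of : TwoReplicaTransienceBound → LandscapeBound` (item 14978, proved);
* `zeroModeOfLandscape_proof` (item 9089), `flatModeFromLandscape_proof` (item 9088),
  `occupationStability_proof` (item 9074) — the route's flat-mode glue;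
* `landscapeBound_of_zeroMode_noIntermittency : WitnessZeroMode → OverlapNoIntermittency →
  LandscapeBound` (line `late-core-split`, p140392).

What it records, kernel-checked and by name: every proof of the crux of route
`BECCutLineWeakDisorder` is — given the route's own rank-4 crux `GroundStateRigidity`
(stmt-AtomisticToContinuum-9072) — a proof of the zero-mode target
`Summit.AtomisticToContinuum.BoseEinsteinCondensation.Theses.BECInfraredBound.BecZeroModeThesis`
(stmt-AtomisticToContinuum-0686, the common target of seven BEC routes), and the same holds for
the two late-time children Z ∧ A of the lossless split `stub_splitOfCrux` (p140379). Together
with `groundStateZeroMode_of_crux` (p140987: on bounded `v` the crux alone gives flat-mode ODLRO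
of the Dirichlet ground state uniformly in `N`) this is the formal content of the leads' verdict
"the crux is not weaker than the summit's zero-mode target" (LeadC7Report §4, LeadC8Report).
-/

noncomputable section

namespace Summit.AtomisticToContinuum.BoseEinsteinCondensation.Cruxes.TwoReplicaTransienceBound.LateCoreSplit

open Summit.AtomisticToContinuum.BoseEinsteinCondensation.Theses
open Summit.AtomisticToContinuum.BoseEinsteinCondensation.Theses.BECCutLineWeakDisorder
open Summit.AtomisticToContinuum.BoseEinsteinCondensation.Theorems

/-- **Hinge + rigidity ⟹ zero-mode target, by name.** `LandscapeBound` (item 9087) and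
`GroundStateRigidity` (item 9072) give `BECInfraredBound.BecZeroModeThesis` (item 0686): the
route's glue items 9089/9088/9074, composed. [folklore] -/
theorem becZeroModeThesis_of_landscape_of_rigidity (hL : LandscapeBound)
    (hR : GroundStateRigidity) : BECInfraredBound.BecZeroModeThesis :=
  zeroModeOfLandscape_proof hL hR flatModeFromLandscape_proof occupationStability_proof

/-- **Crux + rigidity ⟹ zero-mode target, by name** (registered toolbox stub
`stub_zeroModeNecessity` of crux item stmt-AtomisticToContinuum-9687). `TwoReplicaTransienceBound`
(item 9687) and `GroundStateRigidity` (item 9072) give `BECInfraredBound.BecZeroModeThesis`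
(item 0686), through the proved transfer `WitnessTransfer_of` (item 14978). [folklore] -/
theorem stub_zeroModeNecessity : TwoReplicaTransienceBound → GroundStateRigidity → BECInfraredBound.BecZeroModeThesis :=
  fun hT hR => becZeroModeThesis_of_landscape_of_rigidity (WitnessTransfer_of hT) hR

/-- Alias of `stub_zeroModeNecessity` with named hypotheses. [folklore] -/
theorem becZeroModeThesis_of_crux_of_rigidity (hT : TwoReplicaTransienceBound)
    (hR : GroundStateRigidity) : BECInfraredBound.BecZeroModeThesis :=
  stub_zeroModeNecessity hT hR

/-- **Late core + rigidity ⟹ zero-mode target, by name.** The two late-time children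
Z = `WitnessZeroMode` and A = `OverlapNoIntermittency` of the lossless split of the crux
(`stub_splitOfCrux`), together with `GroundStateRigidity`, give
`BECInfraredBound.BecZeroModeThesis` (item 0686), through
`landscapeBound_of_zeroMode_noIntermittency` (p140392). [folklore] -/
theorem becZeroModeThesis_of_zeroMode_noIntermittency_of_rigidity (hZ : WitnessZeroMode)
    (hA : OverlapNoIntermittency) (hR : GroundStateRigidity) :
    BECInfraredBound.BecZeroModeThesis :=
  becZeroModeThesis_of_landscape_of_rigidity (landscapeBound_of_zeroMode_noIntermittency hZ hA) hR

end Summit.AtomisticToContinuum.BoseEinsteinCondensation.Cruxes.TwoReplicaTransienceBound.LateCoreSplit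

end
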